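import Summits.Schanuel.Schanuel.Theorems.DiophantineDichotomyApproximationPropertyCycleAPIAt3Defs
import Summits.Schanuel.Schanuel.Theorems.DiophantineDichotomyApproximationPropertyZeroDimDictionary
import Summits.Schanuel.Schanuel.Theorems.DiophantineDichotomyApproximationPropertyCycleAPIAt3SatelliteHeightLineLemmas
import Literature.NumberTheory.Transcendental.NesterenkoChowFormPrime
import Literature.NumberTheory.Transcendental.NesterenkoUResultant
import HarnessLib

/-!
# Stub plan `CycleAPIAt3`, P3: `stub_satelliteHeightLine : SatelliteHeightLine` (stmt-Schanuel-6117)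

Crux `stmt-Schanuel-6117` (`Summit.Schanuel.Schanuel.Theses.DiophantineDichotomy.ApproximationProperty`),
route `DiophantineDichotomy`, line `orbit-interpolation-determinant`, registered stub
`CycleAPIAt3 : CycleAPIAt 3`; stub plan `Cruxes/ApproximationProperty/STUB-PLAN-CycleAPIAt3.md`, P3
(k1 H7 / k2 H4b). This file PROVES the registered sub-goal
`stub_satelliteHeightLine : SatelliteHeightLine` (vocabulary
`DiophantineDichotomyApproximationPropertyCycleAPIAt3Defs.lean`): there is an absolute `C > 0` such
that a rational LINE `V(𝔩) ⊂ ℙ³` (`𝔩 ⊂ ℚ[x₀, …, x₃]` a homogeneous prime of rank `2` with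
`deg 𝔩 = 1`) carrying a Galois orbit `V(𝔭)` (`𝔭 ⊇ 𝔩` a homogeneous prime of rank `1`) of
`D = deg 𝔭 ≥ 2` points has `h(𝔩) ≤ C (h(𝔭)/D + 1)`.

Proof (the line structure is read off the Chow form, nothing else being known about `𝔩`):
* the 0-dimensional dictionary (landed `stub_zeroDimDictionary`) presents `V(𝔭)` as the conjugates
  `σ(b̄)`, `σ : K → ℂ`, `[K:ℚ] = D`, `h_K(b̄) ≤ h(𝔭) + cD`; `D ≥ 2` gives two embeddings
  `σ₁ ≠ σ₂`, hence two NON-proportional zeros `p = σ₁ b̄`, `q = σ₂ b̄` of `𝔩`, read in the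
  compositum `L = σ₁(K) σ₂(K) ⊂ ℂ`;
* the Chow form `F(u₁, u₂)` of `𝔩` has degree `deg 𝔩 = 1` in each block (LNM 1752 Ch. 3, remark
  after Prop. 4.4), i.e. `F = ∑ M_{ij} u_{1i} u_{2j}`, and `M` is `±`-symmetric (symmetry of `F`
  in `u₁, u₂`); by Prop. 4.4 (zeros of `F`) the bilinear form `M` vanishes on `p^⊥ × p^⊥` and on
  `q^⊥ × q^⊥`, whence (linear algebra, `…SatelliteHeightLineLemmas`) `M = β (q ⊗ p ± p ⊗ q)` —
  the Plücker form of the line `pq`;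
* heights: `h(𝔩) = h(F) ≤ h_ℚ(M) = h_L(M)/[L:ℚ] = h_L(q ⊗ p ± p ⊗ q)/[L:ℚ] ≤
  (h_L(p) + h_L(q))/[L:ℚ] + κ = 2 h_K(b̄)/D + κ ≤ 2 h(𝔭)/D + 2c + κ`
  (`Height.logHeight_smul_eq_logHeight`, the registered `logHeight_wedge_le`, and the
  independence of the absolute height of the field `NguyenRoy.logHeight_comp_div_finrank`).

Sources: NesterenkoPhilippon2001 (LNM 1752) Ch. 3 §4 (Prop. 4.4 and the remark after it, Def. 4.2,
4.5, p. 38); BombieriGubler2006 §1.5, §2.8; Philippon 1986 §1.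
-/

noncomputable section

-- `Summit.Schanuel.Schanuel.…` is the mandated summit/sub-problem namespace (single-conjunct summit), hence:
set_option linter.dupNamespace false

namespace Summit.Schanuel.Schanuel.Cruxes.ApproximationProperty.OrbitInterpolationDeterminant

open Literature.NumberTheory.Transcendental.Nesterenko MvPolynomial
open scoped BigOperators

namespace SatelliteHeightLine

/-- A prime which is unmixed of rank `2` has `dim ℚ[x̲]/𝔩 = 2`. [folklore] -/
theorem rank_eq_two {𝔩 : Ideal (Rx 3)} (h𝔩 : 𝔩.IsPrime) (hunm : IsUnmixedOfRank 𝔩 2) :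
    ringKrullDim (Rx 3 ⧸ 𝔩) = (2 : ℕ) := by
  refine hunm.2 𝔩 ⟨h𝔩, 1, ?_⟩
  have hcol : Submodule.colon 𝔩 {(1 : Rx 3)} = 𝔩 := by
    ext a; rw [Submodule.mem_colon_singleton, smul_eq_mul, mul_one]
  rw [hcol, h𝔩.radical]

end SatelliteHeightLine

open SatelliteHeightLine in
/-- **P3 `SatelliteHeightLine`** (registered sub-goal `stub_satelliteHeightLine`): a rational line
`V(𝔩)` carrying a Galois orbit of `D ≥ 2` points has `h(𝔩) ≤ C (h(𝔭)/D + 1)` with an ABSOLUTE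
constant `C` — the Chow form of the line is the Plücker form `σ₁b̄ ∧ σ₂b̄` of two of the conjugate
points, `h(x ∧ y) ≤ h(x) + h(y) + O(1)`, conjugates are equi-high, and `h_K(b̄) ≤ h(𝔭) + cD`
(dictionary (C)). [cite: NesterenkoPhilippon2001, Ch. 3 Prop. 4.4 and Def. 4.5 (p. 38)] -/
theorem stub_satelliteHeightLine : SatelliteHeightLine := by
  classical
  obtain ⟨c, hc, hZ⟩ := stub_zeroDimDictionary 3 (by norm_num)
  obtain ⟨κ, hκ⟩ := logHeight_wedge_le (3 + 1)
  refine ⟨2 * c + |κ| + 2, by positivity, ?_⟩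
  intro 𝔭 𝔩 h𝔭 h𝔭hom h𝔭unm h𝔩 h𝔩hom h𝔩unm hdeg hle hD
  obtain ⟨K, _, _, b, hb0, hA, hB', hB, hC, -, -⟩ := hZ 𝔭 h𝔭 h𝔭hom h𝔭unm
  -- two distinct embeddings `σ₁ ≠ σ₂` (`D ≥ 2`)
  have hcard : 1 < Fintype.card (K →+* ℂ) := by
    rw [NumberField.Embeddings.card K ℂ, hB]; exact hD
  obtain ⟨σ₁, σ₂, hσ⟩ := Fintype.exists_pair_of_one_lt_card hcard
  -- the compositum `L = σ₁(K) σ₂(K) ⊂ ℂ`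
  haveI : FiniteDimensional ℚ ↥(σ₁.toRatAlgHom).fieldRange :=
    LinearEquiv.finiteDimensional (AlgEquiv.ofInjectiveField σ₁.toRatAlgHom).toLinearEquiv
  haveI : FiniteDimensional ℚ ↥(σ₂.toRatAlgHom).fieldRange :=
    LinearEquiv.finiteDimensional (AlgEquiv.ofInjectiveField σ₂.toRatAlgHom).toLinearEquiv
  set L : IntermediateField ℚ ℂ := (σ₁.toRatAlgHom).fieldRange ⊔ (σ₂.toRatAlgHom).fieldRange
    with hL_def
  haveI : FiniteDimensional ℚ L := IntermediateField.finiteDimensional_sup _ _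
  haveI : NumberField L :=
    Literature.NumberTheory.Transcendental.NguyenRoy.NFPres.numberField_of_intermediateField L
  have h₁ : ∀ x, σ₁ x ∈ L := fun x =>
    (le_sup_left : (σ₁.toRatAlgHom).fieldRange ≤ L) ((AlgHom.mem_fieldRange).mpr ⟨x, rfl⟩)
  have h₂ : ∀ x, σ₂ x ∈ L := fun x =>
    (le_sup_right : (σ₂.toRatAlgHom).fieldRange ≤ L) ((AlgHom.mem_fieldRange).mpr ⟨x, rfl⟩)
  set f₁ : K →+* L := σ₁.codRestrict L h₁ with hf₁_def
  set f₂ : K →+* L := σ₂.codRestrict L h₂ with hf₂_def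
  set p : Fin (3 + 1) → L := fun j => f₁ (b j) with hp_def
  set q : Fin (3 + 1) → L := fun j => f₂ (b j) with hq_def
  obtain ⟨j₀, hj₀⟩ := Function.ne_iff.mp hb0
  have hq0 : q ≠ 0 := fun h => by
    have := congrFun h j₀
    simp only [q, Pi.zero_apply, map_eq_zero] at this
    exact hj₀ this
  -- every conjugate `σ(b̄)` is a zero of `𝔩 ⊆ 𝔭`
  have hmemZ : ∀ σ : K →+* ℂ, (fun j => σ (b j)) ∈ projZeros 𝔩 := fun σ => by
    have hne : (fun j => σ (b j)) ≠ 0 := fun h => hj₀ (by simpa using congrFun h j₀)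
    have h𝔭Z : (fun j => σ (b j)) ∈ projZeros 𝔭 := (hA _).mpr ⟨hne, σ, 1, by simp⟩
    exact ⟨h𝔭Z.1, fun P hP => h𝔭Z.2 P (hle hP)⟩
  -- the Chow form of `𝔩`: a `±`-symmetric bilinear form `M`
  have hdim : ringKrullDim (Rx 3 ⧸ 𝔩) = (2 : ℕ) := rank_eq_two h𝔩 h𝔩unm
  have hpr : (elimIdeal 𝔩 2).IsPrincipal :=
    (isPrincipal_elimIdeal_and_ne_bot 3 2 𝔩 (by norm_num) (by norm_num) h𝔩hom h𝔩 hdim).1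
  have hF0 : chowForm 𝔩 2 ≠ 0 := chowForm_ne_zero_of_prime (s := 1) h𝔩 h𝔩hom hdim
  obtain ⟨c', hc', hsym⟩ := coeff_chowForm_swap hpr hF0
  set g : Fin (3 + 1) × Fin (3 + 1) → ℚ := fun ij =>
    coeff (Finsupp.single (0, ij.1) 1 + Finsupp.single (1, ij.2) 1) (chowForm 𝔩 2) with hg_def
  set M : Matrix (Fin (3 + 1)) (Fin (3 + 1)) L := fun i j => algebraMap ℚ L (g (i, j)) with hM_def
  set cL : L := algebraMap ℚ L c' with hcL_def
  have hcL : cL = 1 ∨ cL = -1 := by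
    rcases hc' with h | h
    · left; rw [hcL_def, h, map_one]
    · right; rw [hcL_def, h, map_neg, map_one]
  have hMsym : ∀ i j, M i j = cL * M j i := fun i j => by
    simp only [M, cL, ← map_mul, g]
    exact congrArg _ (hsym i j)
  -- `M` vanishes on `w^⊥ × w^⊥` for every zero `w` of `𝔩` with coordinates in `L`
  have hzero : ∀ w : Fin (3 + 1) → L, (fun j => (w j : ℂ)) ∈ projZeros 𝔩 →
      ∀ x y : Fin (3 + 1) → L, ∑ k, x k * w k = 0 → ∑ k, y k * w k = 0 →
        ∑ i, ∑ j, x i * M i j * y j = 0 := by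
    intro w hw x y hx hy
    apply (algebraMap L ℂ).injective
    have hx' : ∑ k, (x k : ℂ) * (w k : ℂ) = 0 := by simpa using congrArg (algebraMap L ℂ) hx
    have hy' : ∑ k, (y k : ℂ) * (w k : ℂ) = 0 := by simpa using congrArg (algebraMap L ℂ) hy
    have h := sum_coeff_chowForm_eq_zero h𝔩hom hpr hdeg hw hx' hy'
    rw [map_zero, ← h, map_sum]
    refine Finset.sum_congr rfl fun i _ => ?_
    rw [map_sum]
    refine Finset.sum_congr rfl fun j _ => ?_
    simp only [map_mul, M, g, IntermediateField.algebraMap_apply, eq_ratCast,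
      SubfieldClass.coe_ratCast]
    ring
  -- a non-vanishing minor of `(p, q)` (the two points are distinct, dictionary (B′))
  obtain ⟨i₀, k₀, hmin⟩ : ∃ i j, p i * q j - p j * q i ≠ 0 := by
    refine exists_minor_ne_zero p q hq0 fun l hl => hσ (hB' σ₁ σ₂ l ?_)
    funext j
    have h := congrArg (algebraMap L ℂ) (congrFun hl j)
    simpa [p, q, f₁, f₂] using h
  -- linear algebra: `M = β (q ⊗ p + c p ⊗ q)`
  obtain ⟨β, hβ⟩ := matrix_eq_wedge_of_symm M p q hMsym hmin
    (hzero p (by exact hmemZ σ₁)) (hzero q (by exact hmemZ σ₂))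
  -- heights
  have H1 : iheight 𝔩 2 ≤ Height.logHeight g :=
    height_le_logHeight_coeff _ (bdeg_chowForm_eq_one hdeg)
  have hfinL : (0 : ℝ) < Module.finrank ℚ L := by exact_mod_cast Module.finrank_pos
  have H2 : Height.logHeight g =
      Height.logHeight (fun ij => algebraMap ℚ L (g ij)) / Module.finrank ℚ L := by
    have h := Literature.NumberTheory.Transcendental.NguyenRoy.logHeight_comp_div_finrank
      (algebraMap ℚ L) g
    rw [Module.finrank_self, Nat.cast_one, div_one] at h
    exact h.symm
  set S : Fin (3 + 1) × Fin (3 + 1) → L := fun ij => q ij.1 * p ij.2 + cL * (p ij.1 * q ij.2)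
    with hS_def
  have hgL : (fun ij => algebraMap ℚ L (g ij)) = β • S := funext fun ij => by
    rw [Pi.smul_apply, smul_eq_mul]
    exact hβ ij.1 ij.2
  have H3 : Height.logHeight (fun ij => algebraMap ℚ L (g ij)) ≤ Height.logHeight S := by
    rw [hgL]
    by_cases hβ0 : β = 0
    · rw [hβ0, zero_smul, Height.logHeight_zero]; exact Height.logHeight_nonneg _
    · exact (Height.logHeight_smul_eq_logHeight S hβ0).le
  have H4 : Height.logHeight S ≤ Height.logHeight p + Height.logHeight q + κ * Module.finrank ℚ L :=
    hκ L p q cL hcL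
  have H5p : Height.logHeight p / Module.finrank ℚ L = Height.logHeight b / Module.finrank ℚ K :=
    Literature.NumberTheory.Transcendental.NguyenRoy.logHeight_comp_div_finrank f₁ b
  have H5q : Height.logHeight q / Module.finrank ℚ L = Height.logHeight b / Module.finrank ℚ K :=
    Literature.NumberTheory.Transcendental.NguyenRoy.logHeight_comp_div_finrank f₂ b
  have hDpos : (0 : ℝ) < ideg 𝔭 1 := by exact_mod_cast (by omega : 0 < ideg 𝔭 1)
  have hKD : (Module.finrank ℚ K : ℝ) = ideg 𝔭 1 := by exact_mod_cast hB
  have key : iheight 𝔩 2 ≤ 2 * (Height.logHeight b / ideg 𝔭 1) + κ := by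
    calc iheight 𝔩 2 ≤ Height.logHeight S / Module.finrank ℚ L :=
          H1.trans (H2 ▸ div_le_div_of_nonneg_right H3 hfinL.le)
      _ ≤ (Height.logHeight p + Height.logHeight q + κ * Module.finrank ℚ L) /
            Module.finrank ℚ L := div_le_div_of_nonneg_right H4 hfinL.le
      _ = Height.logHeight p / Module.finrank ℚ L + Height.logHeight q / Module.finrank ℚ L + κ := by
          field_simp
      _ = 2 * (Height.logHeight b / ideg 𝔭 1) + κ := by rw [H5p, H5q, hKD]; ring
  have hb_le : Height.logHeight b / ideg 𝔭 1 ≤ iheight 𝔭 1 / ideg 𝔭 1 + c := by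
    rw [div_add' _ _ _ hDpos.ne', div_le_div_iff_of_pos_right hDpos]
    exact hC
  have hnn : 0 ≤ iheight 𝔭 1 / ideg 𝔭 1 := div_nonneg (height_nonneg _) hDpos.le
  nlinarith [key, hb_le, hnn, le_abs_self κ, abs_nonneg κ,
    mul_nonneg (by positivity : 0 ≤ 2 * c + |κ|) hnn]

end Summit.Schanuel.Schanuel.Cruxes.ApproximationProperty.OrbitInterpolationDeterminant

end
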